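import Literature.NumberTheory.EllipticCurves.NeronModelCodimOne
import Literature.NumberTheory.EllipticCurves.NeronModelExtensionSetup
import Literature.NumberTheory.EllipticCurves.NeronModelWeilFibre
import Literature.RingTheory.CompleteLocalRings.SmoothSectionLift
import Literature.AlgebraicGeometry.Resolution.PrincipalizationToResolution
import HarnessLib

/-!
# Sections of a smooth scheme over a discrete valuation ring are dense in EVERY fibre
# (Artin's hypothesis in Weil's group-chunk theorem): the generic-fibre half, and the assembly over a
# complete dvr with algebraically closed residue field

Topic `Literature/AlgebraicGeometry/Smoothening`, namespace `Literature.AlgebraicGeometry.Smoothening`.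
THEOREMS ONLY (no definition, no named fact, no instance, no `sorry`).  Cell `hodgecm-mathlib`
(D-0151), road W toward r₀, node **(W1e) «section supply»** (A-p06 READFIRST-W1 §3; RULING
2026-08-28T11:54:53Z (ρ1): the sub-line's `HasDenseSections 𝒳` quantifies over all points, both
fibres; `DenseSectionsStrictlyLocal` = complete dvr + algebraically closed residue field + smooth,
quasi-compact, surjective, irreducible fibres ⇒ `HasDenseSections`).

M. Artin, *Néron Models* (Cornell–Silverman 1986), Thm. (1.12) assumes «the Zariski-local sections of
`V/S` are dense in each fibre».  Over a discrete valuation ring `R` (fraction field `K`, closed point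
`𝔪`, generic point `η`) this has two halves.  The CLOSED-fibre half is Hensel's lemma plus density of
rational points (`Literature/RingTheory/CompleteLocalRings/SmoothSectionLift.lean` §3, `R` complete
with algebraically closed residue field).  This file proves the GENERIC-fibre half for ANY dvr and
assembles the two:

* §1 `exists_mem_specializes_of_mem_closure_inter` — topology (Görtz–Wedhorn I, Lemma 10.17 (1),
  pointwise form): in a Noetherian quasi-sober space a point of the closure of `G ∩ C` (`G` open,
  `C` closed) is a specialisation of a point of `G ∩ C`.
* §2 `eq_or_eq_genericPoint_of_specializes` — for `𝒳 → Spec R` smooth with integral total space and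
  `ζ ≠ ξ` (the generic point) with `dim 𝒪_{X,ζ} ≤ 1`, the generisations of `ζ` are `ζ` and `ξ`
  (`𝒪_{X,ζ}` is a dvr, `isDiscreteValuationRing_stalk_of_ringKrullDim_le_one`; Mathlib
  `Scheme.range_fromSpecStalk`).
* §3 `exists_section_apply_genericPoint_mem` — **generic-fibre density**: if `ζ` lies over `𝔪` with
  `dim 𝒪_{X,ζ} ≤ 1` and every open neighbourhood of `ζ` contains the closed point of a section, then
  every non-empty open `Ω ⊆ X` contains the generic point `a(η)` of a section.  Proof: `F := X_K ∖ Ω`,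
  `Z := closure F`; a point of `F` generising `ζ` would be `ξ ∈ Ω` (§1, §2), so `ζ ∉ Z`; a section
  with `a(𝔪) ∉ Z` has `a(η) ∉ Z ⊇ F` (`a(η) ⤳ a(𝔪)`) and `a(η) ∈ X_K`, so `a(η) ∈ Ω`.
* §4 `ringKrullDim_stalk_le_one_of_isGenericPoint_specialFibre` — the generic point of the special
  fibre has `dim 𝒪_{X,ζ} ≤ 1` (Krull's Hauptidealsatz in the tree's geometric form
  `ringKrullDim_stalk_le_one_of_forall_specializes`; the special fibre is `V(ϖ)`,
  `preimage_range_specGenericPoint_eq_basicOpen`).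
* §5 `exists_section_apply_mem_fibre` — **the W1e closer**: for `R` a complete dvr with algebraically
  closed residue field and `𝒳 → Spec R` smooth, quasi-compact, surjective with irreducible fibres,
  every open `Ω ∋ x` contains a point `a(s)` of a section `a` in the fibre of `x` — the body of the
  sub-line's `HasDenseSections 𝒳` verbatim (the def lives in the crux workfile, not importable here).

HC_CM is proved only modulo the 7 printed citations until rung 0 closes; banked leaf, no floor change.

## References
* [Artin1986NeronModels] M. Artin, *Néron Models*, Thm. (1.12) (hypothesis «dense in each fibre») and
  §2, first paragraph of the proof (p. 292 of the held scan `book:cornellnd-arithmetic-geometry`).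
* [GortzWedhorn2020] U. Görtz, T. Wedhorn, *Algebraic Geometry I* (2nd ed.), Lemma 10.17 (1).
* [Liu2002] Q. Liu, *Algebraic Geometry and Arithmetic Curves*, §10.2.2, proof of Lemma 2.12 (c) (p. 493).
* [BLRNeronModels1990] S. Bosch, W. Lütkebohmert, M. Raynaud, *Néron Models*, §2.3 Prop. 5 (not held).
-/

noncomputable section

open CategoryTheory CategoryTheory.Limits IsLocalRing Topology TopologicalSpace
open _root_.AlgebraicGeometry
open Literature.NumberTheory.EllipticCurves

universe u

namespace Literature.AlgebraicGeometry.Smoothening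

/-! ## §1 Topology: specialisations out of the closure of a locally closed set -/

section Topology

variable {α : Type*} [TopologicalSpace α] [NoetherianSpace α] [QuasiSober α]

/-- In a Noetherian quasi-sober space, every point of the closure of a locally closed set `G ∩ C`
(`G` open, `C` closed) is a specialisation of a point of `G ∩ C` — the pointwise form of
Görtz–Wedhorn I, Lemma 10.17 (1) («`C` is closed if and only if `C` is constructible and stable under
specialization», `X` noetherian) for the constructible set `G ∩ C`, proved topologically: decompose
`closure (G ∩ C)` into finitely many irreducible closed sets; the one through `z` is the closure of its
open part in `G`, and its generic point lies in `G` (opens are stable under generisation) and in `C`.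
[cite: GortzWedhorn2020, Lemma 10.17 (1)] -/
theorem exists_mem_specializes_of_mem_closure_inter {G C : Set α} (hG : IsOpen G) (hC : IsClosed C)
    {z : α} (hz : z ∈ closure (G ∩ C)) : ∃ f ∈ G ∩ C, f ⤳ z := by
  obtain ⟨S, hSf, hSc, hSi, hSU⟩ :=
    NoetherianSpace.exists_finite_set_isClosed_irreducible (isClosed_closure (s := G ∩ C))
  -- `G ∩ C = ⋃_{t ∈ S} (G ∩ C ∩ t)`, a finite union; `z` lies in the closure of one piece
  have hcov : G ∩ C ⊆ ⋃ t ∈ S, (G ∩ C) ∩ t := by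
    intro x hx
    have hx' : x ∈ ⋃₀ S := hSU ▸ subset_closure hx
    obtain ⟨t, htS, hxt⟩ := Set.mem_sUnion.mp hx'
    exact Set.mem_biUnion htS ⟨hx, hxt⟩
  have hz' : z ∈ ⋃ t ∈ S, closure ((G ∩ C) ∩ t) := by
    have h := closure_mono hcov hz
    rwa [hSf.closure_biUnion] at h
  obtain ⟨t, htS, hzt⟩ := Set.mem_iUnion₂.mp hz'
  have htC : t ⊆ C := fun x hx =>
    (hC.closure_subset_iff.mpr Set.inter_subset_right) (hSU ▸ Set.mem_sUnion.mpr ⟨t, htS, hx⟩ :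
      x ∈ closure (G ∩ C))
  -- the piece `G ∩ t` is a non-empty open part of the irreducible closed `t`, hence dense in `t`
  have hne : (t ∩ G).Nonempty := by
    by_contra h
    rw [Set.not_nonempty_iff_eq_empty] at h
    have : (G ∩ C) ∩ t = ∅ := by
      rw [Set.eq_empty_iff_forall_notMem]
      rintro x ⟨⟨hxG, -⟩, hxt⟩
      exact (Set.eq_empty_iff_forall_notMem.mp h) x ⟨hxt, hxG⟩
    rw [this, closure_empty] at hzt
    exact hzt
  have hzT : z ∈ t := (hSc t htS).closure_subset_iff.mpr Set.inter_subset_right hzt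
  -- the generic point of `t`
  set c := (hSi t htS).genericPoint with hc
  have hcgen : IsGenericPoint c t := (hSi t htS).isGenericPoint_genericPoint (hSc t htS)
  obtain ⟨g, hgt, hgG⟩ := hne
  have hcG : c ∈ G := (hcgen.specializes hgt).mem_open hG hgG
  exact ⟨c, ⟨hcG, htC hcgen.mem⟩, hcgen.specializes hzT⟩

end Topology

/-! ## §2 Generisations of a codimension-one point of the special fibre -/

section CodimOne

variable {R : Type u} [CommRing R] [IsDomain R] [IsDiscreteValuationRing R]
  {K : Type u} [Field K] [Algebra R K] [IsFractionRing R K]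
  {𝒳 : Over (Spec (.of R))} [Smooth 𝒳.hom] [IsIntegral 𝒳.left]

variable (K) in
/-- The closed point of `Spec R` is not in the image of the generic point `Spec K → Spec R`
(`R` a discrete valuation ring, not a field). [folklore] -/
private theorem closedPoint_notMem_range_specGenericPoint :
    closedPoint R ∉ Set.range (specGenericPoint R K).base := by
  rintro ⟨y, hy⟩
  obtain rfl : y = closedPoint K := Subsingleton.elim _ _
  have h : Ideal.comap (algebraMap R K) (maximalIdeal K) = maximalIdeal R :=
    congrArg PrimeSpectrum.asIdeal hy
  rw [show maximalIdeal K = ⊥ from (isField_iff_maximalIdeal_eq).mp (Field.toIsField K),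
    Ideal.comap_bot_of_injective _ (IsFractionRing.injective R K)] at h
  exact IsDiscreteValuationRing.not_isField R (isField_iff_maximalIdeal_eq.mpr h.symm)

omit [IsDiscreteValuationRing R] in
variable (K) in
/-- The generic point of the (integral) total space lies in the generic fibre. [folklore] -/
private theorem genericPoint_mem_preimage_range_specGenericPoint :
    genericPoint 𝒳.left ∈ 𝒳.hom.base ⁻¹' Set.range (specGenericPoint R K).base := by
  change 𝒳.hom.base (genericPoint 𝒳.left) ∈ Set.range (specGenericPoint R K).base
  rw [apply_genericPoint_eq]
  exact genericPoint_mem_range_specGenericPoint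

/-- In a discrete valuation ring every prime ideal is `⊥` or the maximal ideal. [folklore] -/
private theorem dvr_eq_bot_or_eq_maximalIdeal {A : Type*} [CommRing A]
    [IsDomain A] [IsDiscreteValuationRing A] (p : Ideal A) [p.IsPrime] :
    p = ⊥ ∨ p = maximalIdeal A := by
  by_cases hp : p = ⊥
  · exact Or.inl hp
  · right
    obtain ⟨-, P, -, huniq⟩ := (IsDiscreteValuationRing.iff_pid_with_one_nonzero_prime A).mp ‹_›
    rw [huniq p ⟨hp, ‹_›⟩, huniq (maximalIdeal A)
      ⟨(IsDiscreteValuationRing.not_isField A ∘ isField_iff_maximalIdeal_eq.mpr), inferInstance⟩]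

/-- **The generisations of a codimension-one point outside the generic point.**  Let `𝒳 → Spec R`
be smooth with integral total space `X`, `R` a discrete valuation ring, and `ζ ∈ X` a point which is
not the generic point `ξ` of `X` and with `dim 𝒪_{X,ζ} ≤ 1`.  Then `𝒪_{X,ζ}` is a discrete valuation
ring (`isDiscreteValuationRing_stalk_of_ringKrullDim_le_one`), so `Spec 𝒪_{X,ζ} = {𝔪, (0)}` and the
generisations of `ζ` — the image of `Spec 𝒪_{X,ζ} → X` (Mathlib `Scheme.range_fromSpecStalk`) — are
exactly `ζ` and `ξ`.  (The sentence «`𝒪_{V,v}` is a discrete valuation ring» at a codimension-one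
point in Liu's proof of Lemma 10.2.12 (c), read on the underlying space.)
[cite: Liu2002, §10.2.2, proof of Lemma 2.12 (c) (p. 493)] -/
theorem eq_or_eq_genericPoint_of_specializes {ζ : 𝒳.left} (hζ : ζ ≠ genericPoint 𝒳.left)
    (hζ1 : ringKrullDim (𝒳.left.presheaf.stalk ζ) ≤ 1) {y : 𝒳.left} (hy : y ⤳ ζ) :
    y = ζ ∨ y = genericPoint 𝒳.left := by
  haveI := isDiscreteValuationRing_stalk_of_ringKrullDim_le_one (𝒳 := 𝒳) hζ hζ1
  -- every generisation is in the image of `Spec 𝒪_{X,ζ} → X`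
  have hrange : ∀ w : 𝒳.left, w ⤳ ζ → ∃ p, (𝒳.left.fromSpecStalk ζ).base p = w := fun w hw => by
    have h : w ∈ Set.range (𝒳.left.fromSpecStalk ζ).base := by
      rw [Scheme.range_fromSpecStalk]; exact hw
    exact h
  -- the two points of `Spec 𝒪_{X,ζ}`
  have hpts : ∀ p : Spec (𝒳.left.presheaf.stalk ζ),
      p = closedPoint (𝒳.left.presheaf.stalk ζ) ∨ p.asIdeal = ⊥ := fun p => by
    rcases dvr_eq_bot_or_eq_maximalIdeal p.asIdeal with h | h
    · exact Or.inr h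
    · exact Or.inl (PrimeSpectrum.ext h)
  obtain ⟨p, hp⟩ := hrange y hy
  rcases hpts p with h | h
  · left
    rw [← hp, h]
    exact Scheme.fromSpecStalk_closedPoint
  · right
    -- the generic point of `X` is also a generisation of `ζ`, through the point `(0)` as well
    obtain ⟨q, hq⟩ := hrange _ (genericPoint_specializes ζ)
    rcases hpts q with h' | h'
    · exact absurd (by rw [← hq, h']; exact Scheme.fromSpecStalk_closedPoint) (Ne.symm hζ)
    · have hpq : p = q := PrimeSpectrum.ext (h.trans h'.symm)
      rw [← hp, hpq, hq]

end CodimOne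

/-! ## §3 Density of sections in the generic fibre -/

section Generic

variable (R : Type u) [CommRing R] [IsDomain R] [IsDiscreteValuationRing R]

/-- **Sections are dense in the generic fibre as soon as they are dense near a codimension-one point of
the special fibre** (the generic-fibre half of M. Artin, *Néron Models*, Thm. (1.12), hypothesis «the
Zariski-local sections of `V/S` are dense in each fibre», over a discrete valuation ring).  Let
`𝒳 → Spec R` be smooth and quasi-compact with integral total space `X`, `ζ ∈ X` a point of the special
fibre with `dim 𝒪_{X,ζ} ≤ 1` (e.g. the generic point of an irreducible special fibre), and suppose every
open neighbourhood of `ζ` contains the closed point of a section of `𝒳`.  Then every non-empty open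
`Ω ⊆ X` contains the generic point `a(η)` of a section `a : Spec R → X`.  Proof: `F := X_K ∖ Ω`,
`Z := closure F`; a point of `F` generising `ζ` would be `ζ` (not in `X_K`) or the generic point `ξ`
(in `Ω`), so `ζ ∉ Z` (§1, §2); a section with `a(𝔪) ∉ Z` has `a(η) ∉ Z ⊇ F` since `a(η) ⤳ a(𝔪)`, and
`a(η) ∈ X_K`, whence `a(η) ∈ Ω`.
[cite: Artin1986NeronModels, Thm. (1.12) (hypothesis) and §2, first paragraph of the proof] -/
theorem exists_section_apply_genericPoint_mem (𝒳 : Over (Spec (.of R))) [Smooth 𝒳.hom]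
    [QuasiCompact 𝒳.hom] [IsIntegral 𝒳.left] {ζ : 𝒳.left} (hζs : 𝒳.hom.base ζ = closedPoint R)
    (hζ1 : ringKrullDim (𝒳.left.presheaf.stalk ζ) ≤ 1)
    (hsec : ∀ W : 𝒳.left.Opens, ζ ∈ W →
      ∃ a : Spec (.of R) ⟶ 𝒳.left, a ≫ 𝒳.hom = 𝟙 _ ∧ a.base (closedPoint R) ∈ W)
    (Ω : 𝒳.left.Opens) (hΩ : (Ω : Set 𝒳.left).Nonempty) :
    ∃ a : Spec (.of R) ⟶ 𝒳.left, a ≫ 𝒳.hom = 𝟙 _ ∧ a.base (genericPoint (Spec (.of R))) ∈ Ω := by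
  -- Noetherian total space
  haveI : IsLocallyNoetherian 𝒳.left := LocallyOfFiniteType.isLocallyNoetherian 𝒳.hom
  haveI : CompactSpace 𝒳.left := QuasiCompact.compactSpace_of_compactSpace 𝒳.hom
  haveI : IsNoetherian 𝒳.left := {}
  -- the generic fibre `G` (open: `Spec K → Spec R` is an open immersion) and the generic point `ξ ∈ Ω`
  let K : Type u := FractionRing R
  haveI := isOpenImmersion_specGenericPoint R K
  set G : Set 𝒳.left := 𝒳.hom.base ⁻¹' Set.range (specGenericPoint R K).base with hGdef
  have hG : IsOpen G := (specGenericPoint R K).isOpenEmbedding.isOpen_range.preimage 𝒳.hom.continuous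
  set ξ := genericPoint 𝒳.left with hξdef
  have hξΩ : ξ ∈ Ω := ((genericPoint_spec 𝒳.left).mem_open_set_iff Ω.2).mpr (by simpa using hΩ)
  have hξG : ξ ∈ G := genericPoint_mem_preimage_range_specGenericPoint (𝒳 := 𝒳) K
  have hζG : ζ ∉ G := fun h => closedPoint_notMem_range_specGenericPoint (R := R) K (hζs ▸ h)
  have hζξ : ζ ≠ ξ := fun h => hζG (h ▸ hξG)
  -- `F := G ∖ Ω`, `Z := closure F`; KEY: `ζ ∉ Z`
  set F : Set 𝒳.left := G ∩ (Ω : Set 𝒳.left)ᶜ with hFdef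
  have hζZ : ζ ∉ closure F := by
    intro hζZ
    obtain ⟨f, ⟨hfG, hfΩ⟩, hfζ⟩ :=
      exists_mem_specializes_of_mem_closure_inter hG Ω.2.isClosed_compl hζZ
    rcases eq_or_eq_genericPoint_of_specializes hζξ hζ1 hfζ with rfl | rfl
    · exact hζG hfG
    · exact hfΩ hξΩ
  -- a section through the open `X ∖ Z ∋ ζ`
  let W : 𝒳.left.Opens := ⟨(closure F)ᶜ, isClosed_closure.isOpen_compl⟩
  obtain ⟨a, ha, haW⟩ := hsec W hζZ
  refine ⟨a, ha, ?_⟩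
  -- `a(η) ⤳ a(𝔪) ∉ Z`, so `a(η) ∉ Z ⊇ F`; and `a(η) ∈ G`
  have hsp : a.base (genericPoint (Spec (.of R))) ⤳ a.base (closedPoint R) :=
    (genericPoint_specializes (closedPoint R)).map a.base.hom.continuous
  have hηZ : a.base (genericPoint (Spec (.of R))) ∉ closure F :=
    fun h => haW (isClosed_closure.stableUnderSpecialization hsp h)
  have hηG : a.base (genericPoint (Spec (.of R))) ∈ G := by
    change 𝒳.hom.base (a.base _) ∈ Set.range (specGenericPoint R K).base
    have h := congrArg (fun φ : Spec (.of R) ⟶ Spec (.of R) => φ.base (genericPoint (Spec (.of R)))) ha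
    simp only [Scheme.Hom.comp_base, TopCat.comp_app, Scheme.Hom.id_base, TopCat.id_app] at h
    rw [h]
    exact genericPoint_mem_range_specGenericPoint
  by_contra hηΩ
  exact hηZ (subset_closure ⟨hηG, hηΩ⟩)

end Generic

/-! ## §4 Krull: the generic point of the special fibre has codimension one -/

section Krull

variable {R : Type u} [CommRing R] [IsDomain R] [IsDiscreteValuationRing R]

/-- `Spec` of a discrete valuation ring has two points: a point other than the closed point is the
generic point. [folklore] -/
private theorem eq_genericPoint_of_ne_closedPoint {p : Spec (.of R)} (hp : p ≠ closedPoint R) :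
    p = genericPoint (Spec (.of R)) := by
  rw [genericPoint_eq_bot_of_affine]
  apply PrimeSpectrum.ext
  rcases dvr_eq_bot_or_eq_maximalIdeal p.asIdeal with h | h
  · exact h
  · exact absurd (PrimeSpectrum.ext h) hp

/-- **The generic point of the special fibre is a codimension-one point** (Krull's principal ideal
theorem): for `𝒳 → Spec R` locally of finite type over a discrete valuation ring `R` and `ζ` a generic
point of the (closed) special fibre `𝒳_s`, `dim 𝒪_{X,ζ} ≤ 1` — the special fibre is the zero locus
`V(ϖ)` of a uniformizer (`preimage_range_specGenericPoint_eq_basicOpen`), `ζ` is a maximal point of it,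
and `ringKrullDim_stalk_le_one_of_forall_specializes` (Hauptidealsatz) applies.  This is the input
«`𝒪_{X,ζ}` is a discrete valuation ring with uniformizer `π`» of the Néron-model literature
(Bosch–Lütkebohmert–Raynaud; Liu, proof of Lemma 10.2.12 (c)).
[cite: Liu2002, §10.2.2, proof of Lemma 2.12 (c) (p. 493)] -/
theorem ringKrullDim_stalk_le_one_of_isGenericPoint_specialFibre (𝒳 : Over (Spec (.of R)))
    [LocallyOfFiniteType 𝒳.hom] {ζ : 𝒳.left}
    (hζ : IsGenericPoint ζ (𝒳.hom.base ⁻¹' {closedPoint R})) :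
    ringKrullDim (𝒳.left.presheaf.stalk ζ) ≤ 1 := by
  haveI : IsLocallyNoetherian 𝒳.left := LocallyOfFiniteType.isLocallyNoetherian 𝒳.hom
  let K : Type u := FractionRing R
  obtain ⟨ϖ, hϖ⟩ := IsDiscreteValuationRing.exists_irreducible R
  let t : Γ(𝒳.left, ⊤) := 𝒳.hom.appTop ((Scheme.ΓSpecIso (.of R)).inv ϖ)
  have hG : 𝒳.hom.base ⁻¹' Set.range (specGenericPoint R K).base = (𝒳.left.basicOpen t : Set 𝒳.left) :=
    preimage_range_specGenericPoint_eq_basicOpen K 𝒳.hom hϖ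
  -- a point outside `D(t)` lies over the closed point
  have hout : ∀ y : 𝒳.left, y ∉ 𝒳.left.basicOpen t → 𝒳.hom.base y = closedPoint R := by
    intro y hy
    by_contra hne
    apply hy
    have hyG : y ∈ 𝒳.hom.base ⁻¹' Set.range (specGenericPoint R K).base := by
      change 𝒳.hom.base y ∈ Set.range (specGenericPoint R K).base
      rw [eq_genericPoint_of_ne_closedPoint hne]
      exact genericPoint_mem_range_specGenericPoint
    rw [hG] at hyG
    exact hyG
  have hζs : 𝒳.hom.base ζ = closedPoint R := hζ.mem
  have hζt : ζ ∉ 𝒳.left.basicOpen t := by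
    intro h
    have h' : ζ ∈ 𝒳.hom.base ⁻¹' Set.range (specGenericPoint R K).base := by rw [hG]; exact h
    exact closedPoint_notMem_range_specGenericPoint (R := R) K (hζs ▸ h')
  refine ringKrullDim_stalk_le_one_of_forall_specializes t hζt fun y hyζ hyt => ?_
  -- `y` lies in the special fibre and generises its generic point, so `y = ζ`
  have hyS : y ∈ 𝒳.hom.base ⁻¹' {closedPoint R} := hout y hyt
  have hS : IsClosed (𝒳.hom.base ⁻¹' {closedPoint R}) :=
    (IsLocalRing.isClosed_singleton_closedPoint (R := R)).preimage 𝒳.hom.continuous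
  have h1 : closure {y} ⊆ 𝒳.hom.base ⁻¹' {closedPoint R} :=
    hS.closure_subset_iff.mpr (Set.singleton_subset_iff.mpr hyS)
  have h2 : 𝒳.hom.base ⁻¹' {closedPoint R} ⊆ closure {y} := by
    rw [← hζ.def]
    exact closure_minimal (Set.singleton_subset_iff.mpr hyζ.mem_closure) isClosed_closure
  exact IsGenericPoint.eq (h1.antisymm h2) hζ

end Krull

/-! ## §5 The W1e closer: Artin's hypothesis over a complete dvr with algebraically closed residue field -/

section StrictlyLocal

variable (R : Type u) [CommRing R] [IsDomain R] [IsDiscreteValuationRing R]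
  [IsAdicComplete (maximalIdeal R) R]

/-- **Sections of a smooth surjective `𝒳 → Spec R` with irreducible fibres over a complete discrete
valuation ring with algebraically closed residue field are Zariski-dense in EVERY fibre** — the
hypothesis «the Zariski-local sections of `V/S` are dense in each fibre» of M. Artin, *Néron Models*,
Thm. (1.12), in the shape `HasDenseSections` of the road-W sub-line (A-p06, W1 head v3): for every point
`x` and open `Ω ∋ x` there is a section `a` of `𝒳` meeting `Ω` in the fibre of `x`.  Closed fibre:
Hensel + density of rational points (`CompleteLocalRings.exists_section_left_apply_mem`); generic fibre:
`exists_section_apply_genericPoint_mem` at the generic point `ζ` of the special fibre, which has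
codimension one (`ringKrullDim_stalk_le_one_of_isGenericPoint_specialFibre`).
[cite: Artin1986NeronModels, Thm. (1.12) (hypothesis) and §2, first paragraph of the proof] -/
theorem exists_section_apply_mem_fibre (hk : IsAlgClosed (ResidueField R))
    (𝒳 : Over (Spec (.of R))) [Smooth 𝒳.hom] [QuasiCompact 𝒳.hom] (hsurj : Surjective 𝒳.hom)
    (hirr : ∀ s : Spec (.of R), IsPreirreducible (𝒳.hom.base ⁻¹' {s}))
    (x : 𝒳.left) (Ω : 𝒳.left.Opens) (hx : x ∈ Ω) :
    ∃ a : Spec (.of R) ⟶ 𝒳.left, a ≫ 𝒳.hom = 𝟙 (Spec (.of R)) ∧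
      ∃ s : Spec (.of R), a.base s ∈ Ω ∧ 𝒳.hom.base (a.base s) = 𝒳.hom.base x := by
  haveI := hk
  have hsec_apply : ∀ {a : Spec (.of R) ⟶ 𝒳.left}, a ≫ 𝒳.hom = 𝟙 _ → ∀ s, 𝒳.hom.base (a.base s) = s :=
    fun {a} ha s => by
      have h := congrArg (fun φ : Spec (.of R) ⟶ Spec (.of R) => φ.base s) ha
      simpa only [Scheme.Hom.comp_base, TopCat.comp_app, Scheme.Hom.id_base, TopCat.id_app] using h
  by_cases hxs : 𝒳.hom.base x = closedPoint R
  · -- closed fibre: Hensel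
    obtain ⟨a, ha, haΩ⟩ :=
      Literature.RingTheory.CompleteLocalRings.exists_section_left_apply_mem R 𝒳 Ω hx hxs
    exact ⟨a, ha, closedPoint R, haΩ, by rw [hsec_apply ha, hxs]⟩
  · -- generic fibre
    have hxη : 𝒳.hom.base x = genericPoint (Spec (.of R)) := eq_genericPoint_of_ne_closedPoint hxs
    -- the special fibre and its generic point `ζ`
    set S₀ : Set 𝒳.left := 𝒳.hom.base ⁻¹' {closedPoint R} with hS₀
    have hS₀c : IsClosed S₀ := (IsLocalRing.isClosed_singleton_closedPoint (R := R)).preimage 𝒳.hom.continuous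
    have hS₀i : IsIrreducible S₀ := ⟨let ⟨z, hz⟩ := hsurj.1 (closedPoint R); ⟨z, hz⟩, hirr _⟩
    set ζ := hS₀i.genericPoint with hζdef
    have hζ : IsGenericPoint ζ S₀ := hS₀i.isGenericPoint_genericPoint hS₀c
    have hζs : 𝒳.hom.base ζ = closedPoint R := hζ.mem
    -- the total space is integral: reduced (regular) and irreducible (the irreducible generic fibre is dense)
    haveI : IsLocallyNoetherian 𝒳.left := LocallyOfFiniteType.isLocallyNoetherian 𝒳.hom
    haveI : IsReduced 𝒳.left :=
      (Literature.AlgebraicGeometry.Resolution.Scheme.IsRegular.of_smooth 𝒳.hom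
        (Literature.AlgebraicGeometry.Resolution.Scheme.isRegular_Spec (.of R))).isReduced
    let K : Type u := FractionRing R
    have hrange : Set.range (specGenericPoint R K).base = {genericPoint (Spec (.of R))} := by
      rw [Set.range_unique, Set.singleton_eq_singleton_iff]
      obtain ⟨y, hy⟩ := genericPoint_mem_range_specGenericPoint (R := R) (K := K)
      rw [← hy, Subsingleton.elim default y]
    have hGd : Dense (𝒳.hom.base ⁻¹' {genericPoint (Spec (.of R))}) := by
      rw [← hrange, ← Scheme.Pullback.range_fst]
      haveI := isSchemeTheoreticallyDominant_pullback_fst_specGenericPoint R K 𝒳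
      exact (pullback.fst 𝒳.hom (specGenericPoint R K)).denseRange
    haveI : IrreducibleSpace 𝒳.left := by
      rw [irreducibleSpace_def, Set.top_eq_univ]
      have h := (hirr (genericPoint (Spec (.of R)))).closure
      rw [hGd.closure_eq] at h
      exact ⟨⟨x, trivial⟩, h⟩
    haveI : IsIntegral 𝒳.left := isIntegral_of_irreducibleSpace_of_isReduced _
    -- codimension one at `ζ`, sections near `ζ` by Hensel, then the generic-fibre density theorem
    have hζ1 := ringKrullDim_stalk_le_one_of_isGenericPoint_specialFibre 𝒳 hζ
    obtain ⟨a, ha, haΩ⟩ := exists_section_apply_genericPoint_mem R 𝒳 hζs hζ1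
      (fun W hW => Literature.RingTheory.CompleteLocalRings.exists_section_left_apply_mem R 𝒳 W hW hζs)
      Ω ⟨x, hx⟩
    exact ⟨a, ha, genericPoint _, haΩ, by rw [hsec_apply ha, hxη]⟩

end StrictlyLocal

end Literature.AlgebraicGeometry.Smoothening

end
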